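import Summits.AtomisticToContinuum.Crystallization.Theorems.ExcessDecayLiouvilleDefs

/-!
# `ExcessDecayLiouville.HcpLiouville` (stmt-AtomisticToContinuum-9332): vocabulary of the line `two-level-caccioppoli`

Route `ExcessDecayLiouville` (sub-problem `Crystallization`), crux `HcpLiouville` (rank 3): every separated
Lennard-Jones equilibrium globally two-way `1/40`-matched with an admissible affine hcp two-lattice is one.
This file only NAMES the objects the crux line `two-level-caccioppoli` (Cruxes/HcpLiouville, card of
ideator 1; lead skeleton `Lines/Sketch.lean`) posits, over the route's mirror predicates
`Λ₀ / Adm₀ / Inner₀ / Sites₀ / Hess₀ / nnForm / hessForm` (`PhononStability/Negative/Mirror.lean`) and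
`Near₀ / Sep₀ / Equil₀` (`ExcessDecayLiouvilleDefs.lean`), so that the line's stubs can be landed as
`--supports` helpers with literally matching signatures:

* `IsDisplacement X t A u` — `X = {s + u s : s ∈ Sites₀ t A}` bijectively with `‖u‖∞ ≤ 1/40`;
* `anchorDatum t τ`, `shiftField t A τ` — the datum with sublattice `1` translated by `τ`, and the
  field `τ·𝟙₁`;
* `hessFormAt t A w φ` — the second variation at the DISPLACED configuration `s ↦ s + w s`
  (`hessFormAt t A 0 = hessForm t A` termwise);
* `BoxCoercive η κ₁` — tangent coercivity on the `η`-box around every admissible hcp-like datum;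
* `secHess`, `secFormAt`, `SecantCoercive ρ κ₁` — the θ-averaged (ray-secant) bilinear form from an
  anchored equilibrium two-lattice and its coercivity;
* `GrowthBound t A v` — `Σ_{B_R(c)} |Dv|²_nn ≤ C·R` uniformly in the centre;
* `NNFlat t A u` — every period difference `u(· + Az) − u` is constant across nearest-neighbour bonds.

All predicates carry parameters (route-internal bookkeeping, not literature facts); everything is
`[folklore]`; nothing here closes an item.
-/

noncomputable section

namespace Summit.AtomisticToContinuum.Crystallization.Theorems.ExcessDecayLiouville

open scoped BigOperators Topology Classical InnerProductSpace
open Literature.MathematicalPhysics.StatisticalMechanics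
open Summit.AtomisticToContinuum.Crystallization.Theorems.PhononStabilityNegative

/-- **Displacement form**: `u` carries the reference sites `Sites₀ t A` bijectively onto `X`, moving each
site by at most `1/40` (values of `u` off the site set are irrelevant). [folklore] -/
def IsDisplacement (X : Set (EuclideanSpace ℝ (Fin 3))) (t : Fin 2 → EuclideanSpace ℝ (Fin 3))
    (A : EuclideanSpace ℝ (Fin 3) →L[ℝ] EuclideanSpace ℝ (Fin 3))
    (u : EuclideanSpace ℝ (Fin 3) → EuclideanSpace ℝ (Fin 3)) : Prop :=
  (∀ s ∈ Sites₀ t A, ‖u s‖ ≤ 1 / 40) ∧ Set.BijOn (fun s => s + u s) (Sites₀ t A) X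

/-- **Anchored datum**: the sublattice translations `t` with sublattice `1` moved by `τ`
(`anchorDatum t τ 0 = t 0`, `anchorDatum t τ 1 = t 1 + τ`). [folklore] -/
def anchorDatum (t : Fin 2 → EuclideanSpace ℝ (Fin 3)) (τ : EuclideanSpace ℝ (Fin 3)) :
    Fin 2 → EuclideanSpace ℝ (Fin 3) :=
  Function.update t 1 (t 1 + τ)

/-- **The field `τ·𝟙₁`** of the datum `(t, A)`: `τ` on the sites of sublattice `1` (`t 1 + A Λ₀`),
`0` elsewhere. [folklore] -/
def shiftField (t : Fin 2 → EuclideanSpace ℝ (Fin 3))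
    (A : EuclideanSpace ℝ (Fin 3) →L[ℝ] EuclideanSpace ℝ (Fin 3)) (τ : EuclideanSpace ℝ (Fin 3)) :
    EuclideanSpace ℝ (Fin 3) → EuclideanSpace ℝ (Fin 3) :=
  fun s => if ∃ z ∈ Λ₀, s = t 1 + A z then τ else 0

/-- **Second variation at a displaced configuration**: the ordered-pair double sum of the pair
force-constant forms `Hess₀` over the reference sites, with bond vectors taken at the displaced positions
`(p + w p) − (q + w q)` and evaluated on the test differences `φ p − φ q`. [folklore] -/
def hessFormAt (t : Fin 2 → EuclideanSpace ℝ (Fin 3))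
    (A : EuclideanSpace ℝ (Fin 3) →L[ℝ] EuclideanSpace ℝ (Fin 3))
    (w φ : EuclideanSpace ℝ (Fin 3) → EuclideanSpace ℝ (Fin 3)) : ℝ :=
  ∑' p : Sites₀ t A, ∑' q : Sites₀ t A,
    if (p : EuclideanSpace ℝ (Fin 3)) ≠ q then
      Hess₀ ((p : EuclideanSpace ℝ (Fin 3)) + w p - ((q : EuclideanSpace ℝ (Fin 3)) + w q)) (φ p - φ q)
    else 0

/-- **Box (tangent) coercivity at radius `η` with constant `κ₁`**: for every admissible cell `A`
(`Adm₀`), hcp-like translations `t` (`Inner₀`), every displacement `w` of the sites with `‖w s‖ ≤ η`, and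
every finitely supported test field `φ` on the sites,
`κ₁ · nnForm t A φ ≤ ½ · hessFormAt t A w φ`. [folklore] -/
def BoxCoercive (η κ₁ : ℝ) : Prop :=
  ∀ (t : Fin 2 → EuclideanSpace ℝ (Fin 3)) (A : EuclideanSpace ℝ (Fin 3) →L[ℝ] EuclideanSpace ℝ (Fin 3)),
    Adm₀ A → Inner₀ t A →
    ∀ w : EuclideanSpace ℝ (Fin 3) → EuclideanSpace ℝ (Fin 3), (∀ s ∈ Sites₀ t A, ‖w s‖ ≤ η) →
      ∀ φ : EuclideanSpace ℝ (Fin 3) → EuclideanSpace ℝ (Fin 3),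
        (Function.support φ).Finite → Function.support φ ⊆ Sites₀ t A →
          κ₁ * nnForm t A φ ≤ hessFormAt t A w φ / 2

/-- **Secant pair form**: the θ-average over `[0,1]` of `Hess₀ (e + θ d) w` (interval integral). [folklore] -/
def secHess (e d w : EuclideanSpace ℝ (Fin 3)) : ℝ :=
  ∫ θ in (0 : ℝ)..1, Hess₀ (e + θ • d) w

/-- **Ray-secant bilinear form** from the reference `Sites₀ t A` to the configuration `s ↦ s + v s`,
on the test field `φ` (ordered pairs). [folklore] -/
def secFormAt (t : Fin 2 → EuclideanSpace ℝ (Fin 3))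
    (A : EuclideanSpace ℝ (Fin 3) →L[ℝ] EuclideanSpace ℝ (Fin 3))
    (v φ : EuclideanSpace ℝ (Fin 3) → EuclideanSpace ℝ (Fin 3)) : ℝ :=
  ∑' p : Sites₀ t A, ∑' q : Sites₀ t A,
    if (p : EuclideanSpace ℝ (Fin 3)) ≠ q then
      secHess ((p : EuclideanSpace ℝ (Fin 3)) - q) (v p - v q) (φ p - φ q)
    else 0

/-- **Ray-secant coercivity at anchor radius `ρ` with constant `κ₁`**: for an admissible hcp-like datum
`(t, A)`, an anchor `τ` with `‖τ‖ ≤ ρ` whose anchored datum is again hcp-like and whose site set is in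
Lennard-Jones force balance, and every field `v` on the anchored sites whose endpoint configuration lies in
the `1/40`-box of the ORIGINAL datum (`‖v s + τ𝟙₁ s‖ ≤ 1/40`), the θ-averaged form along the ray
dominates `κ₁ ×` the nearest-neighbour strain form of every finitely supported test field. [folklore] -/
def SecantCoercive (ρ κ₁ : ℝ) : Prop :=
  ∀ (t : Fin 2 → EuclideanSpace ℝ (Fin 3)) (A : EuclideanSpace ℝ (Fin 3) →L[ℝ] EuclideanSpace ℝ (Fin 3))
    (τ : EuclideanSpace ℝ (Fin 3)), Adm₀ A → Inner₀ t A → ‖τ‖ ≤ ρ →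
    Inner₀ (anchorDatum t τ) A → Equil₀ (Sites₀ (anchorDatum t τ) A) →
      ∀ v : EuclideanSpace ℝ (Fin 3) → EuclideanSpace ℝ (Fin 3),
        (∀ s ∈ Sites₀ (anchorDatum t τ) A, ‖v s + shiftField (anchorDatum t τ) A τ s‖ ≤ 1 / 40) →
        ∀ φ : EuclideanSpace ℝ (Fin 3) → EuclideanSpace ℝ (Fin 3),
          (Function.support φ).Finite → Function.support φ ⊆ Sites₀ (anchorDatum t τ) A →
            κ₁ * nnForm (anchorDatum t τ) A φ ≤ secFormAt (anchorDatum t τ) A v φ / 2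

/-- **Linear growth of the nearest-neighbour strain energy**: for some `C`, on every closed ball of radius
`R ≥ 1` the ordered-pair nearest-neighbour (`≤ 11/10`) sum of `‖v p − v q‖²` with `p` in the ball is
`≤ C·R`. [folklore] -/
def GrowthBound (t : Fin 2 → EuclideanSpace ℝ (Fin 3))
    (A : EuclideanSpace ℝ (Fin 3) →L[ℝ] EuclideanSpace ℝ (Fin 3))
    (v : EuclideanSpace ℝ (Fin 3) → EuclideanSpace ℝ (Fin 3)) : Prop :=
  ∃ C : ℝ, ∀ (c : EuclideanSpace ℝ (Fin 3)) (R : ℝ), 1 ≤ R →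
    (∑' p : {s : EuclideanSpace ℝ (Fin 3) // s ∈ Sites₀ t A ∧ dist s c ≤ R}, ∑' q : Sites₀ t A,
      if dist (p : EuclideanSpace ℝ (Fin 3)) q ≤ 11 / 10 then ‖v p - v q‖ ^ 2 else 0) ≤ C * R

/-- **Flat period differences**: for every lattice vector `z ∈ Λ₀` the difference field
`u(· + A z) − u` takes equal values at the two ends of every nearest-neighbour (`≤ 11/10`) pair of
reference sites. [folklore] -/
def NNFlat (t : Fin 2 → EuclideanSpace ℝ (Fin 3))
    (A : EuclideanSpace ℝ (Fin 3) →L[ℝ] EuclideanSpace ℝ (Fin 3))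
    (u : EuclideanSpace ℝ (Fin 3) → EuclideanSpace ℝ (Fin 3)) : Prop :=
  ∀ z ∈ Λ₀, ∀ p ∈ Sites₀ t A, ∀ q ∈ Sites₀ t A, dist p q ≤ 11 / 10 →
    u (p + A z) - u p = u (q + A z) - u q

/-! ### Elementary API -/

local notation "E3" => EuclideanSpace ℝ (Fin 3)

/-- Registered sub-goal carrying this vocabulary file (crux stmt-AtomisticToContinuum-9332, line `Sketch`): the shift
field of the anchored datum takes the value `τ` at the anchored origin of sublattice `1`. [folklore] -/
theorem hcpLiouville_vocabulary :
    ∀ (t : Fin 2 → E3) (A : E3 →L[ℝ] E3) (τ : E3), shiftField (anchorDatum t τ) A τ (anchorDatum t τ 1) = τ := by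
  intro t A τ
  have h : ∃ z ∈ Λ₀, anchorDatum t τ 1 = anchorDatum t τ 1 + A z := ⟨0, zero_mem_Λ₀, by simp⟩
  simp only [shiftField, if_pos h]


/-- The anchored datum keeps sublattice `0`. [folklore] -/
@[simp] theorem anchorDatum_zero (t : Fin 2 → EuclideanSpace ℝ (Fin 3)) (τ : EuclideanSpace ℝ (Fin 3)) :
    anchorDatum t τ 0 = t 0 := by
  simp [anchorDatum]

/-- The anchored datum moves sublattice `1` by `τ`. [folklore] -/
@[simp] theorem anchorDatum_one (t : Fin 2 → EuclideanSpace ℝ (Fin 3)) (τ : EuclideanSpace ℝ (Fin 3)) :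
    anchorDatum t τ 1 = t 1 + τ := by
  simp [anchorDatum]

/-- Anchoring by `0` does nothing. [folklore] -/
@[simp] theorem anchorDatum_zero_shift (t : Fin 2 → EuclideanSpace ℝ (Fin 3)) : anchorDatum t 0 = t := by
  funext m
  fin_cases m <;> simp [anchorDatum]

/-- The zero shift field vanishes. [folklore] -/
@[simp] theorem shiftField_zero (t : Fin 2 → EuclideanSpace ℝ (Fin 3))
    (A : EuclideanSpace ℝ (Fin 3) →L[ℝ] EuclideanSpace ℝ (Fin 3)) : shiftField t A 0 = 0 := by
  funext s
  simp [shiftField]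

/-- Box coercivity is monotone in the radius and in the constant. [folklore] -/
theorem BoxCoercive.mono {η η' κ κ' : ℝ} (h : BoxCoercive η κ) (hη : η' ≤ η) (hκ : κ' ≤ κ) :
    BoxCoercive η' κ' := by
  intro t A hA hI w hw φ hφ hφS
  have h1 := h t A hA hI w (fun s hs => (hw s hs).trans hη) φ hφ hφS
  have h0 : 0 ≤ nnForm t A φ := nnForm_nonneg t A φ
  nlinarith

end Summit.AtomisticToContinuum.Crystallization.Theorems.ExcessDecayLiouville

end
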